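import Literature.MathematicalPhysics.QuantumFieldTheory.Balaban1983to89.T4MultilevelCombRegular

/-!
# T4 — NE1′ / O-G1′: the `k`-uniform multilevel comb-gauge bound LOCALISED to the block tower over the bond

Literature layer, kernel-checked, tree-first (cell `pub-balaban`, row `T4-O3.E-NE1′-OG1′-MULTILEVEL-LOC*`, owner
lineage `pv04`; parents `T4MultilevelCombGauge` (the multilevel rooted comb gauge `multiComb`, `multilevel_bound`) and
`T4MultilevelCombRegular` (the `k`-uniform bound `multilevel_bound_regular` under the (52)-FORMAT finest-scale
regularity `FineRegular`, GLOBAL curvature sups on all of `ℤ^d`, and a GLOBAL sup `X` of the top-level relative deviation)).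

WHAT THIS FILE DOES.  It re-proves the `k`-uniform multilevel bound with its hypotheses LOCALISED: the bound on the
relative deviation `‖(U₁^g)(b)·U₀(b)⁻¹ − 1‖` of the fine bond `b = ⟨x, x + e_ν⟩` in the multilevel comb gauge `g` (uniform
scale list `[L, …, L]`, `k` levels, top gauge `hTop` FREE) is derived from (52)-FORMAT curvature bounds
`‖Uᵢ(∂p) − 1‖ ≤ aᵢ·L^{−2k}` on the fine plaquettes `p` with all four corners in the TWO TOP BLOCKS OVER `b`,
`B^k(c₋) ∪ B^k(c₊)` (`c₋ = L^k·⌊x/L^k⌋`, `c₊ = c₋ + L^k e_ν`; the region predicate is the imported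
`B8Lemma1Lattice.InPair (L^k) (corner (L^k) x) ν`), and from the relative deviation of the top pair on the ONE top bond
`⟨⌊x/L^k⌋, ⌊x/L^k⌋ + e_ν⟩` over `b` — instead of global sups (and `a₁ + a₀ ≥ 0`, automatic for `k ≥ 1`, `d ≥ 2`
by `FineRegularOn.nonneg`, needed at `k = 0` where the region has no plaquette):
`‖(U₁^g)(b)·U₀(b)⁻¹ − 1‖ ≤ crossConst d L/(L² − 1)·(a₁ + a₀) + ‖(scaled (L^k) U₁)^{hTop}⟨x_k, ν⟩·(scaled (L^k) U₀)⟨x_k, ν⟩⁻¹ − 1‖`,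
`x_k = blockIndex (L^k) x` (`multilevel_bound_regular_local`, §6; `crossConst d L/(L² − 1) ≤ (d−1)(2d−1)`,
`multilevel_bound_regular_local_dconst`; top pair agreeing on the top bond ⇒ the first term alone, `same_top_bond_bound`).

§1 pointwise gauge invariance of the curvature deviation (`norm_plaq_gaugeAct_sub_one_eq`), hence of a LOCAL curvature
bound on a block pair (`plaqSupPair_gaugeAct`).  §2 THE ROOTED BOUND IN LOCAL FORM (`bond_bound_rooted`): the rooted
block-wise comb gauge of `T4MultilevelCombGauge` §3 bounds the bond `b` by `crossConst d L·(q₁ + q₀)` with `qᵢ` curvature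
bounds on the block PAIR over `b` only (`T4BlockwiseCombGauge.bond_bound_blockComb` BY NAME) plus the relative deviation of
the coarse pair, in the root gauge, on the ONE coarse bond over `b` (`T4BlockwiseCombGauge.norm_cornerBond_sub_one_eq` BY
NAME).  §3 lattice geometry of the block tower: composition of block indices `⌊⌊x/L⌋/L'⌋ = ⌊x/(LL')⌋`, the pair region as a
box, its convexity, its behaviour under refinement of scale (the level-`j` block pair over `b` lies under the fine region of
the level-`(j+1)` pair; the two top blocks contain every lower pair).  §4 THE LOCAL STOKES TRANSFER (`plaqSupPair_scaled`): a
fine curvature bound `a` on the plaquettes of the scale-`N·L` pair region gives the coarse curvature bound `N²·a` on the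
plaquettes of the scale-`L` pair region of the `N`-blocked configuration `scaled N U`
(`T4BlockTransport.norm_plaq_blockCfg_sub_one_le`, the LOCAL `N × N`-rectangle form, BY NAME, through the dictionary
`T4MultilevelCombGauge.blockCfg_eq_scaled`).  §5 THE MULTILEVEL BOUND WITH PER-LEVEL LOCAL HYPOTHESES
(`multilevel_bound_local`, induction on `k` as in `T4MultilevelCombGauge.multilevel_bound`).  §6 the (52)-format local
regularity `FineRegularOn` and the headline; the global theorem's hypotheses imply the local ones
(`fineRegularOn_of_fineRegular`), so `T4MultilevelCombRegular.multilevel_bound_regular`'s bound with a global top sup `X`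
is recovered (example).  §7 non-vacuity / sanity.

PRINTED STATUS.  NOTHING printed enters any declaration; every declaration is [folklore] and kernel-proved.  CONTEXT ONLY
(quoted VERBATIM from the page renders read as images by this seat, `b2b-balaban-ref1/pages/…`): the ONE-LEVEL locality
remark of [Balaban1985RegularSpaces] (T. Bałaban, "Spaces of Regular Gauge Field Configurations on a Lattice and Gauge
Fixing Conditions", CMP 99 (1985) 75–102), p. 80 l. 3–5 (render `1985-cmp99-regular-spaces-gauge-fixing-p006-x2.png`):
«From this proof it follows that the result is local in the sense that the bound (1.25) for a bond b depends on bounds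
(1.7), (1.24) on B(c₋)∪B(c₊), if b belongs to this set.» — printed for ONE averaging step and Bałaban's axial gauge with
the small-field condition (1.24); this file ITERATES the corresponding locality of the lineage's relative comb gauge over
`k` levels, where the region becomes the two TOP blocks over `b` and the free datum becomes the one top bond over `b`.  The
`k`-level locality analogue printed by Bałaban concerns the AVERAGES, not a gauge: [Balaban1985Averaging] (CMP 98 (1985)
17–51) p. 26, after (54) (render `1985-cmp98-averaging-p010-x2.png`): «The result is local in the sense that if
p = ⟨x, y, z, w⟩, then it is enough to assume (52) for p ⊂ B^k(x)∪B^k(y)∪B^k(z)∪B^k(w).»  Neither sentence is used as a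
hypothesis or discharged here.

WHAT THIS FILE DOES NOT DO.  (i) No averaging operation, no average / root condition ((61), (81)), no small-field
condition (1.24): the top gauge `hTop` and the top-bond deviation stay FREE data.  (ii) Uniform scale `L ≥ 2` only
(`List.replicate k L`); the general scale lists of `T4MultilevelCombGauge.multilevel_bound` are not localised here.  (iii)
Sup norm per bond only — no Hölder / derivative norms, no complex window, no factorised (complexified) pairs.  (iv) The
constant is the lineage's `crossConst d L/(L² − 1)` bookkeeping, not an optimisation; print's «for L large it is too weak»
(p. 80) applies verbatim.  Value = kernel bookkeeping (locality of an already landed bound); NOT an estimate of print's,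
NOT summit progress.
-/

namespace Literature.MathematicalPhysics.QuantumFieldTheory.Balaban1983to89.T4MultilevelCombLocal

open Finset
open B8Lemma1Lattice (e site yplus InPair)
open T4RelativeLadder (UnitaryLike norm_conj_sub_one_eq)
open T4RelativeComb (Cfg gaugeAct plaq plaq_gaugeAct unitaryLike_gaugeAct)
open T4RelativeCombCrossing (pert crossConst PlaqSupPair)
open T4BlockwiseCombGauge (corner isCorner_corner inBlock_corner coarse bond_bound_blockComb norm_cornerBond_sub_one_eq)
open T4BlockTransport (norm_plaq_blockCfg_sub_one_le)
open T4MultilevelCombGauge (blockIndex cornerOf scaled scaled_one scaled_scaled liftGauge unitaryLike_liftGauge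
  scaled_gaugeAct_liftGauge rooted gaugeAct_rooted multiComb multiComb_cons multiComb_nil unitaryLike_multiComb
  unitaryLike_scaled blockCfg_eq_scaled cornerOf_eq_nsmul hol_line_eq_one)
open T4MultilevelCombRegular (FineRegular geom_sum_sq_le crossConst_nonneg crossConst_div_le multilevel_bound_regular)

variable {R : Type*} [NormedRing R] {d : ℕ}

/-- [folklore] Local shorthand for the site lattice `ℤ^d` (the carrier of `T4MultilevelCombGauge.Site d`, definitionally). -/
abbrev Site (d : ℕ) : Type := Fin d → ℤ

example (d : ℕ) : Site d = T4MultilevelCombGauge.Site d := rfl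

/-! ## §1  Pointwise gauge invariance of the curvature deviation -/

/-- [folklore] The curvature deviation at a plaquette is invariant under a unitary-like gauge transformation (based
plaquettes transform by conjugation at the base point; conjugation by a unitary-like unit is an isometry of `‖· − 1‖`). -/
theorem norm_plaq_gaugeAct_sub_one_eq [NormOneClass R] {H : Site d → Rˣ} (hH : ∀ x, UnitaryLike (H x)) (U : Cfg d R)
    (x : Site d) (ρ κ : Fin d) : ‖(plaq (gaugeAct H U) x ρ κ : R) - 1‖ = ‖(plaq U x ρ κ : R) - 1‖ := by
  rw [plaq_gaugeAct, Units.val_mul, Units.val_mul, norm_conj_sub_one_eq (hH x)]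

/-- [folklore] … hence a LOCAL curvature bound on a block pair is gauge invariant. -/
theorem plaqSupPair_gaugeAct [NormOneClass R] {H : Site d → Rˣ} (hH : ∀ x, UnitaryLike (H x)) {U : Cfg d R} {L : ℕ}
    {y : Site d} {μ : Fin d} {q : ℝ} (h : PlaqSupPair L y μ (fun x ρ κ => ‖(plaq U x ρ κ : R) - 1‖) q) :
    PlaqSupPair L y μ (fun x ρ κ => ‖(plaq (gaugeAct H U) x ρ κ : R) - 1‖) q := by
  intro x ρ κ hρκ h1 h2 h3 h4
  show ‖(plaq (gaugeAct H U) x ρ κ : R) - 1‖ ≤ q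
  rw [norm_plaq_gaugeAct_sub_one_eq hH]
  exact h x ρ κ hρκ h1 h2 h3 h4

/-! ## §2  The rooted block-wise comb gauge bound in LOCAL form -/

/-- [folklore] **THE ROOTED BOUND, LOCAL FORM**: for a unitary-like pair `(U₀, U₁)`, ANY unitary-like root values `h` on
the coarse lattice, and the fine bond `b = ⟨x, x + e_ν⟩` with `y = corner L x`: if the curvatures of `U₁`, `U₀` are
`≤ q₁`, `≤ q₀` on the plaquettes of the block pair `B(y) ∪ B(y + Le_ν)` over `b`, then in the rooted gauge `g`
`‖(U₁^g)(b)·U₀(b)⁻¹ − 1‖ ≤ crossConst d L·(q₁ + q₀) + ‖(scaled L U₁)^h⟨⌊x/L⌋, ν⟩·(scaled L U₀)⟨⌊x/L⌋, ν⟩⁻¹ − 1‖` — the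
free number is the relative deviation of the coarse pair IN THE GAUGE `h` on the ONE coarse bond over `b`
(`bond_bound_blockComb` for the pair `(U₀, U₁^{liftGauge h})`, gauge invariance of the local curvature bound, and the
corner crossing bond identified by `norm_cornerBond_sub_one_eq`). -/
theorem bond_bound_rooted [NormOneClass R] {U₀ U₁ : Cfg d R} {h : Site d → Rˣ} {L : ℕ} {q₁ q₀ : ℝ}
    (hU₀ : ∀ x ν, UnitaryLike (U₀ x ν)) (hU₁ : ∀ x ν, UnitaryLike (U₁ x ν)) (hh : ∀ y', UnitaryLike (h y'))
    (hL : 1 ≤ L) (x : Site d) (ν : Fin d)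
    (hq₁ : PlaqSupPair L (corner L x) ν (fun x' ρ κ => ‖(plaq U₁ x' ρ κ : R) - 1‖) q₁)
    (hq₀ : PlaqSupPair L (corner L x) ν (fun x' ρ κ => ‖(plaq U₀ x' ρ κ : R) - 1‖) q₀) (hq : 0 ≤ q₁ + q₀) :
    ‖(pert U₀ (gaugeAct (rooted L h U₀ U₁) U₁) x ν : R) - 1‖ ≤
      crossConst d L * (q₁ + q₀) + ‖(pert (scaled L U₀) (gaugeAct h (scaled L U₁)) (blockIndex L x) ν : R) - 1‖ := by
  have hH := unitaryLike_liftGauge hh L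
  rw [gaugeAct_rooted]
  refine (bond_bound_blockComb hU₀ (unitaryLike_gaugeAct hH hU₁) hL x ν (plaqSupPair_gaugeAct hH hq₁) hq₀ hq).trans
    (add_le_add le_rfl (le_of_eq ?_))
  rw [norm_cornerBond_sub_one_eq hU₀ hL (isCorner_corner L x) _ ν, ← scaled_gaugeAct_liftGauge hL h U₁]
  rfl

/-! ## §3  Lattice geometry of the block tower over a bond -/

/-- [folklore] Coordinate formula. -/
theorem blockIndex_apply (L : ℕ) (x : Site d) (i : Fin d) : blockIndex L x i = x i / (L : ℤ) := rfl

/-- [folklore] Coordinate formula. -/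
theorem corner_apply (L : ℕ) (x : Site d) (i : Fin d) : corner L x i = (L : ℤ) * (x i / (L : ℤ)) := rfl

/-- [folklore] Coordinate formula. -/
theorem cornerOf_apply (L : ℕ) (y : Site d) (i : Fin d) : cornerOf L y i = (L : ℤ) * y i := rfl

/-- [folklore] Scale `1`: the block index is the site. -/
theorem blockIndex_one (x : Site d) : blockIndex 1 x = x := by
  funext i; simp [blockIndex_apply]

/-- [folklore] NESTED BLOCKS: `⌊⌊x/L⌋/L'⌋ = ⌊x/(L·L')⌋` coordinatewise. -/
theorem blockIndex_blockIndex (L L' : ℕ) (x : Site d) : blockIndex L' (blockIndex L x) = blockIndex (L * L') x := by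
  funext i
  simp only [blockIndex_apply, Nat.cast_mul]
  exact Int.ediv_ediv_of_nonneg (Int.natCast_nonneg L)

/-- [folklore] The level-`(j+1)` block index is the level-`j` block index of the scale-`L` block index. -/
theorem blockIndex_pow_succ (L j : ℕ) (x : Site d) :
    blockIndex (L ^ (j + 1)) x = blockIndex (L ^ j) (blockIndex L x) := by
  rw [blockIndex_blockIndex, ← pow_succ']

/-- [folklore] The level-`(j+1)` coarse configuration is the level-`j` coarse configuration of the scale-`L` one. -/
theorem scaled_pow_succ (L j : ℕ) (U : Cfg d R) : scaled (L ^ (j + 1)) U = scaled (L ^ j) (scaled L U) := by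
  rw [scaled_scaled, ← pow_succ']

/-- [folklore] Coordinate formula for the far corner `y + Le_μ`. -/
theorem yplus_apply (L : ℕ) (y : Site d) (μ κ : Fin d) :
    yplus L y μ κ = y κ + if κ = μ then (L : ℤ) else 0 := by
  simp only [yplus, site, Pi.single_apply, Nat.cast_ite, Nat.cast_zero]

/-- [folklore] THE PAIR REGION AS A BOX: `x ∈ B(y) ∪ B(y + Le_μ)` iff `y_κ ≤ x_κ < y_κ + L` for `κ ≠ μ` and
`y_μ ≤ x_μ < y_μ + 2L`. -/
theorem inPair_iff_box (L : ℕ) (y : Site d) (μ : Fin d) (s : Site d) :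
    InPair L y μ s ↔ ∀ κ, y κ ≤ s κ ∧ s κ < y κ + (L : ℤ) * (if κ = μ then 2 else 1) := by
  constructor
  · rintro (h | h) κ
    · obtain ⟨h1, h2⟩ := h κ
      by_cases hκ : κ = μ
      · rw [if_pos hκ]; exact ⟨h1, by omega⟩
      · rw [if_neg hκ, mul_one]; exact ⟨h1, h2⟩
    · obtain ⟨h1, h2⟩ := h κ
      rw [yplus_apply] at h1 h2
      by_cases hκ : κ = μ
      · rw [if_pos hκ] at h1 h2 ⊢; exact ⟨by omega, by omega⟩
      · rw [if_neg hκ] at h1 h2 ⊢; rw [mul_one]; exact ⟨by omega, by omega⟩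
  · intro h
    by_cases hμ : s μ < y μ + L
    · left
      intro κ
      obtain ⟨h1, h2⟩ := h κ
      by_cases hκ : κ = μ
      · subst hκ; exact ⟨h1, hμ⟩
      · rw [if_neg hκ, mul_one] at h2; exact ⟨h1, h2⟩
    · right
      intro κ
      obtain ⟨h1, h2⟩ := h κ
      rw [yplus_apply]
      by_cases hκ : κ = μ
      · subst hκ; rw [if_pos rfl] at h2 ⊢; exact ⟨by omega, by omega⟩
      · rw [if_neg hκ, mul_one] at h2; rw [if_neg hκ]; exact ⟨by omega, by omega⟩

/-- [folklore] THE PAIR REGION IS ORDER-CONVEX: a site squeezed coordinatewise between two sites of the region lies in it. -/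
theorem inPair_of_between {L : ℕ} {y : Site d} {μ : Fin d} {p p' s : Site d} (hp : InPair L y μ p)
    (hp' : InPair L y μ p') (h : ∀ κ, p κ ≤ s κ ∧ s κ ≤ p' κ) : InPair L y μ s := by
  rw [inPair_iff_box] at hp hp' ⊢
  intro κ
  obtain ⟨h1, -⟩ := hp κ
  obtain ⟨-, h2⟩ := hp' κ
  obtain ⟨h3, h4⟩ := h κ
  exact ⟨h1.trans h3, h4.trans_lt h2⟩

/-- [folklore] REFINEMENT OF SCALE, CORNERS: if the coarse site `w` lies in the scale-`L` block pair over the coarse site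
`⌊x/N⌋` (direction `ν`), then its fine corner `N·w` lies in the scale-`N·L` block pair over `x`. -/
theorem inPair_cornerOf {L N : ℕ} (hN : 1 ≤ N) (x : Site d) (ν : Fin d) {w : Site d}
    (hw : InPair L (corner L (blockIndex N x)) ν w) : InPair (N * L) (corner (N * L) x) ν (cornerOf N w) := by
  rw [inPair_iff_box] at hw ⊢
  intro κ
  obtain ⟨h1, h2⟩ := hw κ
  simp only [corner_apply, blockIndex_apply, cornerOf_apply, Nat.cast_mul] at h1 h2 ⊢
  rw [Int.ediv_ediv_of_nonneg (Int.natCast_nonneg N)] at h1 h2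
  have hN0 : (0 : ℤ) ≤ N := Int.natCast_nonneg N
  have hN1 : (1 : ℤ) ≤ N := by exact_mod_cast hN
  generalize x κ / ((N : ℤ) * (L : ℤ)) = Q at h1 h2 ⊢
  generalize (if κ = ν then (2 : ℤ) else 1) = m at h2 ⊢
  have h3 := mul_le_mul_of_nonneg_left h1 hN0
  have h4 : w κ + 1 ≤ (L : ℤ) * Q + (L : ℤ) * m := h2
  have h5 := mul_le_mul_of_nonneg_left h4 hN0
  constructor
  · linarith
  · nlinarith

/-- [folklore] REFINEMENT OF SCALE, SQUARES: if the coarse plaquette `(z; ρ, κ)` has its extreme corners `z`, `z + e_ρ + e_κ`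
in the scale-`L` block pair over `⌊x/N⌋`, then every fine site squeezed between `N·z` and `N·(z + e_ρ + e_κ)` lies in the
scale-`N·L` block pair over `x` (the fine `N × N` square under the coarse plaquette). -/
theorem inPair_square {L N : ℕ} (hN : 1 ≤ N) (x : Site d) (ν : Fin d) {z : Site d} {ρ κ : Fin d}
    (h1 : InPair L (corner L (blockIndex N x)) ν z) (h4 : InPair L (corner L (blockIndex N x)) ν (z + e ρ + e κ))
    {p : Site d} (hp : ∀ κ', (N : ℤ) * z κ' ≤ p κ' ∧ p κ' ≤ (N : ℤ) * (z + e ρ + e κ) κ') :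
    InPair (N * L) (corner (N * L) x) ν p :=
  inPair_of_between (inPair_cornerOf hN x ν h1) (inPair_cornerOf hN x ν h4) fun κ' => by
    simpa only [cornerOf_apply] using hp κ'

/-- [folklore] TOWER NESTING: the scale-`M` block pair over `x` is contained in the scale-`M·N` block pair over `x`
(`N ≥ 1`): blocks of a coarser partition are unions of blocks of a finer one. -/
theorem inPair_mono_scale {M N : ℕ} (hN : 1 ≤ N) (x : Site d) (ν : Fin d) {s : Site d}
    (hs : InPair M (corner M x) ν s) : InPair (M * N) (corner (M * N) x) ν s := by
  rw [inPair_iff_box] at hs ⊢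
  intro κ
  obtain ⟨h1, h2⟩ := hs κ
  obtain ⟨h3, h4⟩ := inBlock_corner hN (blockIndex M x) κ
  simp only [corner_apply, blockIndex_apply, Nat.cast_mul] at h1 h2 h3 h4 ⊢
  rw [← Int.ediv_ediv_of_nonneg (Int.natCast_nonneg M)]
  have hM0 : (0 : ℤ) ≤ M := Int.natCast_nonneg M
  have hN1 : (1 : ℤ) ≤ N := by exact_mod_cast hN
  generalize x κ / (M : ℤ) = q at h1 h2 h3 h4 ⊢
  generalize q / (N : ℤ) = Q at h3 h4 ⊢
  have hm : (1 : ℤ) ≤ (if κ = ν then (2 : ℤ) else 1) ∧ (if κ = ν then (2 : ℤ) else 1) ≤ 2 := by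
    split_ifs <;> simp
  generalize (if κ = ν then (2 : ℤ) else 1) = m at h2 hm ⊢
  have h5 := mul_le_mul_of_nonneg_left h3 hM0
  have h6 : q + 1 ≤ (N : ℤ) * Q + N := h4
  have h7 : q + m ≤ (N : ℤ) * Q + (N : ℤ) * m := by nlinarith
  have h8 := mul_le_mul_of_nonneg_left h7 hM0
  constructor
  · linarith
  · nlinarith

/-- [folklore] TOWER NESTING, POWERS: the scale-`L^i` block pair over `x` is contained in the scale-`L^k` one, `i ≤ k`,
`L ≥ 1`. -/
theorem inPair_mono_pow {L : ℕ} (hL : 1 ≤ L) {i k : ℕ} (hik : i ≤ k) (x : Site d) (ν : Fin d) {s : Site d}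
    (hs : InPair (L ^ i) (corner (L ^ i) x) ν s) : InPair (L ^ k) (corner (L ^ k) x) ν s := by
  have e1 : L ^ k = L ^ i * L ^ (k - i) := by rw [← pow_add, Nat.add_sub_cancel' hik]
  rw [e1]
  exact inPair_mono_scale (Nat.one_le_pow _ _ (by omega)) x ν hs

/-! ## §4  The LOCAL Stokes transfer: fine curvature on the tower region ⇒ coarse curvature on the coarse pair -/

/-- [folklore] **LOCAL STOKES TRANSFER**: for a unitary-like `U` and `N ≥ 1`, a curvature bound `a` on the fine
plaquettes with all four corners in the scale-`N·L` block pair over `x` gives the curvature bound `N²·a` on the plaquettes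
(all four corners) of the scale-`L` block pair over `⌊x/N⌋` for the `N`-blocked configuration `scaled N U`
(`T4BlockTransport.norm_plaq_blockCfg_sub_one_le`: non-abelian Stokes on the `N × N` fine square, LOCAL form, BY NAME;
the square lies in the region by `inPair_square`; `a ≥ 0` is automatic from the fine plaquette at the corner `N·z`). -/
theorem plaqSupPair_scaled [NormOneClass R] {U : Cfg d R} (hU : ∀ x ν, UnitaryLike (U x ν)) {L N : ℕ} (hN : 1 ≤ N)
    (x : Site d) (ν : Fin d) {a : ℝ}
    (h : PlaqSupPair (N * L) (corner (N * L) x) ν (fun s ρ κ => ‖(plaq U s ρ κ : R) - 1‖) a) :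
    PlaqSupPair L (corner L (blockIndex N x)) ν (fun z ρ κ => ‖(plaq (scaled N U) z ρ κ : R) - 1‖)
      ((N : ℝ) ^ 2 * a) := by
  intro z ρ κ hρκ h1 _ _ h4
  show ‖(plaq (scaled N U) z ρ κ : R) - 1‖ ≤ (N : ℝ) ^ 2 * a
  -- every fine plaquette of the `N × N` square under the coarse plaquette `(z; ρ, κ)` lies in the fine region
  have hsq : ∀ i i' : ℕ, i < N → i' < N →
      ‖(plaq U (N • z + (i : ℤ) • e ρ + (i' : ℤ) • e κ) ρ κ : R) - 1‖ ≤ a := by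
    intro i i' hi hi'
    have hiN : (i : ℤ) + 1 ≤ N := by exact_mod_cast hi
    have hi'N : (i' : ℤ) + 1 ≤ N := by exact_mod_cast hi'
    have hi0 : (0 : ℤ) ≤ i := Int.natCast_nonneg i
    have hi'0 : (0 : ℤ) ≤ i' := Int.natCast_nonneg i'
    refine h _ ρ κ hρκ ?_ ?_ ?_ ?_
    all_goals
      refine inPair_square hN x ν h1 h4 fun κ' => ?_
      rw [← cornerOf_eq_nsmul]
      simp only [Pi.add_apply, Pi.smul_apply, cornerOf_apply, smul_eq_mul, e, Pi.single_apply, mul_add, mul_ite, mul_one,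
        mul_zero]
      split_ifs <;> omega
  have ha : 0 ≤ a := (norm_nonneg _).trans (hsq 0 0 (Nat.lt_of_lt_of_le Nat.zero_lt_one hN)
    (Nat.lt_of_lt_of_le Nat.zero_lt_one hN))
  rw [← blockCfg_eq_scaled]
  exact norm_plaq_blockCfg_sub_one_le hU N z ρ κ ha hsq


/-! ## §5  The multilevel bound with per-level LOCAL curvature hypotheses -/

/-- [folklore] **THE MULTILEVEL BOUND, LOCAL FORM** (uniform scale `L ≥ 1`, `k` levels): for a unitary-like pair
`(U₀, U₁)`, a unitary-like top gauge `hTop`, the fine bond `b = ⟨x, x + e_ν⟩`, and per-level curvature bounds `qᵢ⁽ʲ⁾` of the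
level-`j` coarse configurations `scaled (L^j) Uᵢ` ON THE LEVEL-`j` BLOCK PAIR OVER `b` only (corner `L·⌊x_j/L⌋`,
`x_j = ⌊x/L^j⌋`, direction `ν`; `j < k`): the multilevel gauge `g` gives
`‖(U₁^g)(b)·U₀(b)⁻¹ − 1‖ ≤ Σ_{j<k} crossConst d L·(q₁⁽ʲ⁾ + q₀⁽ʲ⁾) + ‖top relative deviation at the ONE top bond ⟨x_k, ν⟩ in
the gauge hTop‖` (induction on `k`: `bond_bound_rooted` at the finest scale, the induction hypothesis for the coarse pair
at the site `⌊x/L⌋`, `scaled_pow_succ` / `blockIndex_pow_succ` to re-index levels). -/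
theorem multilevel_bound_local [NormOneClass R] {L : ℕ} (hL : 1 ≤ L) (k : ℕ) :
    ∀ {U₀ U₁ : Cfg d R} {hTop : Site d → Rˣ} {q₁ q₀ : ℕ → ℝ} (x : Site d) (ν : Fin d),
      (∀ x ν, UnitaryLike (U₀ x ν)) → (∀ x ν, UnitaryLike (U₁ x ν)) → (∀ x, UnitaryLike (hTop x)) →
      (∀ j, j < k → PlaqSupPair L (corner L (blockIndex (L ^ j) x)) ν
        (fun z ρ κ => ‖(plaq (scaled (L ^ j) U₁) z ρ κ : R) - 1‖) (q₁ j)) →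
      (∀ j, j < k → PlaqSupPair L (corner L (blockIndex (L ^ j) x)) ν
        (fun z ρ κ => ‖(plaq (scaled (L ^ j) U₀) z ρ κ : R) - 1‖) (q₀ j)) →
      (∀ j, j < k → 0 ≤ q₁ j + q₀ j) →
      ‖(pert U₀ (gaugeAct (multiComb (List.replicate k L) hTop U₀ U₁) U₁) x ν : R) - 1‖ ≤
        ∑ j ∈ range k, crossConst d L * (q₁ j + q₀ j) +
          ‖(pert (scaled (L ^ k) U₀) (gaugeAct hTop (scaled (L ^ k) U₁)) (blockIndex (L ^ k) x) ν : R) - 1‖ := by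
  induction k with
  | zero =>
      intro U₀ U₁ hTop q₁ q₀ x ν _ _ _ _ _ _
      simp only [List.replicate_zero, multiComb_nil, Finset.range_zero, Finset.sum_empty, zero_add, pow_zero, scaled_one,
        blockIndex_one]
      exact le_rfl
  | succ k ih =>
      intro U₀ U₁ hTop q₁ q₀ x ν hU₀ hU₁ hh hq₁ hq₀ hq
      have hV₀ := unitaryLike_scaled hU₀ L
      have hV₁ := unitaryLike_scaled hU₁ L
      have h0 : 0 < k + 1 := Nat.succ_pos k
      -- level 0: the pair itself, on the scale-`L` block pair over `b`
      have hq₁0 : PlaqSupPair L (corner L x) ν (fun z ρ κ => ‖(plaq U₁ z ρ κ : R) - 1‖) (q₁ 0) := by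
        have h := hq₁ 0 h0
        rwa [pow_zero, blockIndex_one, scaled_one] at h
      have hq₀0 : PlaqSupPair L (corner L x) ν (fun z ρ κ => ‖(plaq U₀ z ρ κ : R) - 1‖) (q₀ 0) := by
        have h := hq₀ 0 h0
        rwa [pow_zero, blockIndex_one, scaled_one] at h
      -- levels ≥ 1: the levels of the coarse pair, over the coarse site `⌊x/L⌋`
      have hq₁' : ∀ j, j < k → PlaqSupPair L (corner L (blockIndex (L ^ j) (blockIndex L x))) ν
          (fun z ρ κ => ‖(plaq (scaled (L ^ j) (scaled L U₁)) z ρ κ : R) - 1‖) (q₁ (j + 1)) := by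
        intro j hj
        have h := hq₁ (j + 1) (by omega)
        rwa [blockIndex_pow_succ, scaled_pow_succ] at h
      have hq₀' : ∀ j, j < k → PlaqSupPair L (corner L (blockIndex (L ^ j) (blockIndex L x))) ν
          (fun z ρ κ => ‖(plaq (scaled (L ^ j) (scaled L U₀)) z ρ κ : R) - 1‖) (q₀ (j + 1)) := by
        intro j hj
        have h := hq₀ (j + 1) (by omega)
        rwa [blockIndex_pow_succ, scaled_pow_succ] at h
      have hq' : ∀ j, j < k → 0 ≤ q₁ (j + 1) + q₀ (j + 1) := fun j hj => hq (j + 1) (by omega)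
      have ih' := ih (q₁ := fun j => q₁ (j + 1)) (q₀ := fun j => q₀ (j + 1)) (blockIndex L x) ν hV₀ hV₁ hh hq₁' hq₀' hq'
      rw [← blockIndex_pow_succ, ← scaled_pow_succ, ← scaled_pow_succ] at ih'
      have hb := bond_bound_rooted hU₀ hU₁ (unitaryLike_multiComb (List.replicate k L) hV₀ hV₁ hh) hL x ν hq₁0 hq₀0
        (hq 0 h0)
      rw [List.replicate_succ, multiComb_cons, Finset.sum_range_succ']
      linarith

/-! ## §6  (52)-format regularity ON THE TWO TOP BLOCKS OVER THE BOND, and the `k`-uniform local bound -/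

/-- [folklore] FINEST-SCALE REGULARITY OF (52) / (1.7) FORMAT, LOCALISED: `‖U(∂p) − 1‖ ≤ a·η²`, `η = L^{−k}`, for the fine
plaquettes `p` with all four corners in the two top blocks `B^k(c₋) ∪ B^k(c₊)` over the bond `⟨x, x + e_ν⟩`
(`c₋ = L^k·⌊x/L^k⌋`, `c₊ = c₋ + L^k e_ν`).  A TYPE, not a printed statement. -/
def FineRegularOn (L k : ℕ) (a : ℝ) (U : Cfg d R) (x : Site d) (ν : Fin d) : Prop :=
  PlaqSupPair (L ^ k) (corner (L ^ k) x) ν (fun s ρ κ => ‖(plaq U s ρ κ : R) - 1‖) (a / ((L : ℝ) ^ k) ^ 2)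

/-- [folklore] Global (52)-format regularity (`T4MultilevelCombRegular.FineRegular`) implies the local one at every bond. -/
theorem fineRegularOn_of_fineRegular {L k : ℕ} {a : ℝ} {U : Cfg d R} (h : FineRegular L k a U) (x : Site d)
    (ν : Fin d) : FineRegularOn L k a U x ν :=
  fun s ρ κ hρκ _ _ _ _ => h s ρ κ hρκ

/-- [folklore] Monotonicity in the constant. -/
theorem FineRegularOn.mono {L k : ℕ} {a a' : ℝ} {U : Cfg d R} {x : Site d} {ν : Fin d} (h : FineRegularOn L k a U x ν)
    (haa' : a ≤ a') : FineRegularOn L k a' U x ν :=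
  fun s ρ κ hρκ h1 h2 h3 h4 =>
    (h s ρ κ hρκ h1 h2 h3 h4).trans (div_le_div_of_nonneg_right haa' (sq_nonneg _))

/-- [folklore] WHEN THE CONSTANT IS AUTOMATICALLY `≥ 0`: for `k ≥ 1`, `L ≥ 2`, `d ≥ 2` the region contains a plaquette
(the one at the corner `c₋` in the directions `0, 1`), so `FineRegularOn L k a U x ν` forces `0 ≤ a`.  (For `k = 0` the
region `{x, x + e_ν}` contains no plaquette and the predicate is vacuous — whence the hypothesis `0 ≤ a₁ + a₀` of the
headline.) -/
theorem FineRegularOn.nonneg {L k : ℕ} {a : ℝ} {U : Cfg d R} {x : Site d} {ν : Fin d} (h : FineRegularOn L k a U x ν)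
    (hL : 2 ≤ L) (hk : 1 ≤ k) (hd : 2 ≤ d) : 0 ≤ a := by
  have hLk : L ≤ L ^ k := by
    calc L = L ^ 1 := (pow_one L).symm
      _ ≤ L ^ k := Nat.pow_le_pow_right (by omega) hk
  have h2 : (2 : ℤ) ≤ ((L ^ k : ℕ) : ℤ) := by exact_mod_cast hL.trans hLk
  have hρκ : (⟨0, by omega⟩ : Fin d) ≠ ⟨1, hd⟩ := by simp [Fin.ext_iff]
  have hc : ∀ s : Site d, (∀ κ', corner (L ^ k) x κ' ≤ s κ' ∧ s κ' ≤ corner (L ^ k) x κ' + 1) →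
      InPair (L ^ k) (corner (L ^ k) x) ν s := by
    intro s hs
    rw [inPair_iff_box]
    intro κ'
    obtain ⟨h1, h3⟩ := hs κ'
    refine ⟨h1, ?_⟩
    split_ifs <;> omega
  have hreal : (1 : ℝ) ≤ L := by exact_mod_cast (by omega : 1 ≤ L)
  have hLk' : 0 < ((L : ℝ) ^ k) ^ 2 := by positivity
  have h0 := (norm_nonneg _).trans (h (corner (L ^ k) x) ⟨0, by omega⟩ ⟨1, hd⟩ hρκ (hc _ fun κ' => by simp)
    (hc _ fun κ' => ?_) (hc _ fun κ' => ?_) (hc _ fun κ' => ?_))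
  · exact (div_nonneg_iff.1 h0).elim (fun h => h.1) fun h => absurd h.2 (not_le.2 hLk')
  all_goals
    simp only [Pi.add_apply, e, Pi.single_apply]
    split_ifs <;> omega

/-- [folklore] THE LEVEL-`j` LOCAL HYPOTHESES DISCHARGED from the top-block regularity: for `j < k`, `L ≥ 1`, a
unitary-like `U` with `FineRegularOn L k a U x ν`, the level-`j` coarse configuration has curvature `≤ (L^j)²·a/L^{2k}` on
the level-`j` block pair over the bond (tower nesting `inPair_mono_pow` + `plaqSupPair_scaled`). -/
theorem levelLocal_of_fineRegularOn [NormOneClass R] {U : Cfg d R} (hU : ∀ x ν, UnitaryLike (U x ν)) {L : ℕ}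
    (hL : 1 ≤ L) {k : ℕ} {a : ℝ} {x : Site d} {ν : Fin d} (h : FineRegularOn L k a U x ν) {j : ℕ} (hj : j < k) :
    PlaqSupPair L (corner L (blockIndex (L ^ j) x)) ν (fun z ρ κ => ‖(plaq (scaled (L ^ j) U) z ρ κ : R) - 1‖)
      (((L : ℝ) ^ j) ^ 2 * (a / ((L : ℝ) ^ k) ^ 2)) := by
  have hN : 1 ≤ L ^ j := Nat.one_le_pow _ _ (by omega)
  have h' : PlaqSupPair (L ^ j * L) (corner (L ^ j * L) x) ν (fun s ρ κ => ‖(plaq U s ρ κ : R) - 1‖)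
      (a / ((L : ℝ) ^ k) ^ 2) := by
    intro s ρ κ hρκ h1 h2 h3 h4
    rw [← pow_succ] at h1 h2 h3 h4
    exact h s ρ κ hρκ (inPair_mono_pow hL hj x ν h1) (inPair_mono_pow hL hj x ν h2) (inPair_mono_pow hL hj x ν h3)
      (inPair_mono_pow hL hj x ν h4)
  have h2 := plaqSupPair_scaled hU hN x ν h'
  rwa [Nat.cast_pow] at h2

/-- [folklore] **THE `k`-UNIFORM MULTILEVEL BOUND, LOCAL FORM** (`L ≥ 2`): for a unitary-like pair `(U₀, U₁)` with
(52)-format regularity `aᵢ·L^{−2k}` on the fine plaquettes of the TWO TOP BLOCKS over the bond `b = ⟨x, x + e_ν⟩` only,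
`a₁ + a₀ ≥ 0` (automatic for `k ≥ 1`, `d ≥ 2`, `FineRegularOn.nonneg`; needed at `k = 0`), and ANY unitary-like top gauge
`hTop`, the multilevel comb gauge `g` gives
`‖(U₁^g)(b)·U₀(b)⁻¹ − 1‖ ≤ crossConst d L/(L² − 1)·(a₁ + a₀) + ‖(scaled (L^k) U₁)^{hTop}⟨x_k, ν⟩·(scaled (L^k) U₀)⟨x_k, ν⟩⁻¹ − 1‖`,
`x_k = ⌊x/L^k⌋` — the bound depends only on data over `b`: the curvatures in the block tower and the ONE top bond
(`levelLocal_of_fineRegularOn` at every level, `multilevel_bound_local`, the geometric series `geom_sum_sq_le`). -/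
theorem multilevel_bound_regular_local [NormOneClass R] {L : ℕ} (k : ℕ) {U₀ U₁ : Cfg d R} {hTop : Site d → Rˣ}
    {a₁ a₀ : ℝ} (hU₀ : ∀ x ν, UnitaryLike (U₀ x ν)) (hU₁ : ∀ x ν, UnitaryLike (U₁ x ν))
    (hh : ∀ x, UnitaryLike (hTop x)) (hL : 2 ≤ L) (x : Site d) (ν : Fin d) (ha₁ : FineRegularOn L k a₁ U₁ x ν)
    (ha₀ : FineRegularOn L k a₀ U₀ x ν) (ha : 0 ≤ a₁ + a₀) :
    ‖(pert U₀ (gaugeAct (multiComb (List.replicate k L) hTop U₀ U₁) U₁) x ν : R) - 1‖ ≤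
      crossConst d L / ((L : ℝ) ^ 2 - 1) * (a₁ + a₀) +
        ‖(pert (scaled (L ^ k) U₀) (gaugeAct hTop (scaled (L ^ k) U₁)) (blockIndex (L ^ k) x) ν : R) - 1‖ := by
  have hd : 1 ≤ d := by have := ν.isLt; omega
  have hL1 : 1 ≤ L := by omega
  have hLr : (2 : ℝ) ≤ L := by exact_mod_cast hL
  have hLk : 0 < ((L : ℝ) ^ k) ^ 2 := by positivity
  have hpos : 0 < (L : ℝ) ^ 2 - 1 := by nlinarith
  -- the three hypotheses of `multilevel_bound_local`, level by level
  have hq₁ : ∀ j, j < k → PlaqSupPair L (corner L (blockIndex (L ^ j) x)) ν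
      (fun z ρ κ => ‖(plaq (scaled (L ^ j) U₁) z ρ κ : R) - 1‖)
      ((fun j => ((L : ℝ) ^ j) ^ 2 * (a₁ / ((L : ℝ) ^ k) ^ 2)) j) :=
    fun j hj => levelLocal_of_fineRegularOn hU₁ hL1 ha₁ hj
  have hq₀ : ∀ j, j < k → PlaqSupPair L (corner L (blockIndex (L ^ j) x)) ν
      (fun z ρ κ => ‖(plaq (scaled (L ^ j) U₀) z ρ κ : R) - 1‖)
      ((fun j => ((L : ℝ) ^ j) ^ 2 * (a₀ / ((L : ℝ) ^ k) ^ 2)) j) :=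
    fun j hj => levelLocal_of_fineRegularOn hU₀ hL1 ha₀ hj
  have hq : ∀ j, j < k → 0 ≤ (fun j => ((L : ℝ) ^ j) ^ 2 * (a₁ / ((L : ℝ) ^ k) ^ 2)) j +
      (fun j => ((L : ℝ) ^ j) ^ 2 * (a₀ / ((L : ℝ) ^ k) ^ 2)) j := by
    intro j _
    have e1 : ((L : ℝ) ^ j) ^ 2 * (a₁ / ((L : ℝ) ^ k) ^ 2) + ((L : ℝ) ^ j) ^ 2 * (a₀ / ((L : ℝ) ^ k) ^ 2) =
        ((L : ℝ) ^ j) ^ 2 * ((a₁ + a₀) / ((L : ℝ) ^ k) ^ 2) := by ring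
    show 0 ≤ ((L : ℝ) ^ j) ^ 2 * (a₁ / ((L : ℝ) ^ k) ^ 2) + ((L : ℝ) ^ j) ^ 2 * (a₀ / ((L : ℝ) ^ k) ^ 2)
    rw [e1]; exact mul_nonneg (sq_nonneg _) (div_nonneg ha hLk.le)
  have h := multilevel_bound_local hL1 k x ν hU₀ hU₁ hh hq₁ hq₀ hq
  have hsum : ∑ j ∈ range k, crossConst d L *
      (((L : ℝ) ^ j) ^ 2 * (a₁ / ((L : ℝ) ^ k) ^ 2) + ((L : ℝ) ^ j) ^ 2 * (a₀ / ((L : ℝ) ^ k) ^ 2)) =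
      crossConst d L * ((∑ j ∈ range k, ((L : ℝ) ^ j) ^ 2) * ((a₁ + a₀) / ((L : ℝ) ^ k) ^ 2)) := by
    rw [Finset.sum_mul, Finset.mul_sum]
    refine Finset.sum_congr rfl fun j _ => ?_
    ring
  rw [hsum] at h
  -- the geometric series: crossConst·(Σ L^{2j})·((a₁+a₀)/L^{2k}) ≤ crossConst/(L²−1)·(a₁+a₀)
  have hC := crossConst_nonneg hd hL1
  have hgeom := geom_sum_sq_le (by nlinarith : (1 : ℝ) < (L : ℝ) ^ 2) k
  have key : crossConst d L * ((∑ j ∈ range k, ((L : ℝ) ^ j) ^ 2) * ((a₁ + a₀) / ((L : ℝ) ^ k) ^ 2)) ≤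
      crossConst d L / ((L : ℝ) ^ 2 - 1) * (a₁ + a₀) :=
    calc crossConst d L * ((∑ j ∈ range k, ((L : ℝ) ^ j) ^ 2) * ((a₁ + a₀) / ((L : ℝ) ^ k) ^ 2))
        ≤ crossConst d L * ((((L : ℝ) ^ k) ^ 2 / ((L : ℝ) ^ 2 - 1)) * ((a₁ + a₀) / ((L : ℝ) ^ k) ^ 2)) :=
          mul_le_mul_of_nonneg_left (mul_le_mul_of_nonneg_right hgeom (div_nonneg ha hLk.le)) hC
      _ = crossConst d L / ((L : ℝ) ^ 2 - 1) * (a₁ + a₀) := by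
          field_simp
  linarith

/-- [folklore] **THE `k`- AND `L`-FREE LOCAL FORM**: `≤ (d−1)(2d−1)·(a₁ + a₀) + ‖top-bond relative deviation‖`
(`T4MultilevelCombRegular.crossConst_div_le`). -/
theorem multilevel_bound_regular_local_dconst [NormOneClass R] {L : ℕ} (k : ℕ) {U₀ U₁ : Cfg d R}
    {hTop : Site d → Rˣ} {a₁ a₀ : ℝ} (hU₀ : ∀ x ν, UnitaryLike (U₀ x ν)) (hU₁ : ∀ x ν, UnitaryLike (U₁ x ν))
    (hh : ∀ x, UnitaryLike (hTop x)) (hL : 2 ≤ L) (x : Site d) (ν : Fin d) (ha₁ : FineRegularOn L k a₁ U₁ x ν)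
    (ha₀ : FineRegularOn L k a₀ U₀ x ν) (ha : 0 ≤ a₁ + a₀) :
    ‖(pert U₀ (gaugeAct (multiComb (List.replicate k L) hTop U₀ U₁) U₁) x ν : R) - 1‖ ≤
      ((d : ℝ) - 1) * (2 * (d : ℝ) - 1) * (a₁ + a₀) +
        ‖(pert (scaled (L ^ k) U₀) (gaugeAct hTop (scaled (L ^ k) U₁)) (blockIndex (L ^ k) x) ν : R) - 1‖ := by
  have hd : 1 ≤ d := by have := ν.isLt; omega
  have h := multilevel_bound_regular_local k hU₀ hU₁ hh hL x ν ha₁ ha₀ ha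
  have hc := mul_le_mul_of_nonneg_right (crossConst_div_le hd hL) ha
  linarith

/-- [folklore] **THE SAME-TOP-BOND COROLLARY**: if the top pair AGREES on the one top bond over `b` in the gauge `hTop`
(`(scaled (L^k) U₁)^{hTop}⟨x_k, ν⟩ = (scaled (L^k) U₀)⟨x_k, ν⟩`), the bound is `crossConst d L/(L² − 1)·(a₁ + a₀)` alone. -/
theorem same_top_bond_bound [NormOneClass R] {L : ℕ} (k : ℕ) {U₀ U₁ : Cfg d R} {hTop : Site d → Rˣ} {a₁ a₀ : ℝ}
    (hU₀ : ∀ x ν, UnitaryLike (U₀ x ν)) (hU₁ : ∀ x ν, UnitaryLike (U₁ x ν)) (hh : ∀ x, UnitaryLike (hTop x))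
    (hL : 2 ≤ L) (x : Site d) (ν : Fin d) (ha₁ : FineRegularOn L k a₁ U₁ x ν) (ha₀ : FineRegularOn L k a₀ U₀ x ν)
    (ha : 0 ≤ a₁ + a₀)
    (htop : gaugeAct hTop (scaled (L ^ k) U₁) (blockIndex (L ^ k) x) ν = scaled (L ^ k) U₀ (blockIndex (L ^ k) x) ν) :
    ‖(pert U₀ (gaugeAct (multiComb (List.replicate k L) hTop U₀ U₁) U₁) x ν : R) - 1‖ ≤
      crossConst d L / ((L : ℝ) ^ 2 - 1) * (a₁ + a₀) := by
  have h := multilevel_bound_regular_local k hU₀ hU₁ hh hL x ν ha₁ ha₀ ha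
  have h0 : ‖(pert (scaled (L ^ k) U₀) (gaugeAct hTop (scaled (L ^ k) U₁)) (blockIndex (L ^ k) x) ν : R) - 1‖ = 0 := by
    rw [norm_eq_zero, sub_eq_zero, pert, htop, mul_inv_cancel, Units.val_one]
  linarith


/-! ## §7  Consistency with the global theorem, non-vacuity, sanity -/

/-- Consistency: the GLOBAL hypotheses of `T4MultilevelCombRegular.multilevel_bound_regular` (regularity on all of `ℤ^d`,
a global top sup `X`; here with `a₁ + a₀ ≥ 0`, which for `d ≥ 2` follows from `FineRegular.nonneg`) give its bound through
the LOCAL theorem. -/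
example [NormOneClass R] {L : ℕ} (k : ℕ) {U₀ U₁ : Cfg d R} {hTop : Site d → Rˣ} {a₁ a₀ X : ℝ}
    (hU₀ : ∀ x ν, UnitaryLike (U₀ x ν)) (hU₁ : ∀ x ν, UnitaryLike (U₁ x ν)) (hh : ∀ x, UnitaryLike (hTop x))
    (hL : 2 ≤ L) (ha₁ : FineRegular L k a₁ U₁) (ha₀ : FineRegular L k a₀ U₀) (ha : 0 ≤ a₁ + a₀)
    (hX : ∀ z ν, ‖(pert (scaled (L ^ k) U₀) (gaugeAct hTop (scaled (L ^ k) U₁)) z ν : R) - 1‖ ≤ X)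
    (x : Site d) (ν : Fin d) :
    ‖(pert U₀ (gaugeAct (multiComb (List.replicate k L) hTop U₀ U₁) U₁) x ν : R) - 1‖ ≤
      crossConst d L / ((L : ℝ) ^ 2 - 1) * (a₁ + a₀) + X :=
  (multilevel_bound_regular_local k hU₀ hU₁ hh hL x ν (fineRegularOn_of_fineRegular ha₁ x ν)
    (fineRegularOn_of_fineRegular ha₀ x ν) ha).trans (add_le_add le_rfl (hX _ ν))

/-- The same bound from the landed GLOBAL theorem, for comparison (no sign hypothesis needed there: for `d = 1` it holds
with `crossConst 1 L = 0`). -/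
example [NormOneClass R] {L : ℕ} (k : ℕ) {U₀ U₁ : Cfg d R} {hTop : Site d → Rˣ} {a₁ a₀ X : ℝ}
    (hU₀ : ∀ x ν, UnitaryLike (U₀ x ν)) (hU₁ : ∀ x ν, UnitaryLike (U₁ x ν)) (hh : ∀ x, UnitaryLike (hTop x))
    (hL : 2 ≤ L) (ha₁ : FineRegular L k a₁ U₁) (ha₀ : FineRegular L k a₀ U₀)
    (hX : ∀ z ν, ‖(pert (scaled (L ^ k) U₀) (gaugeAct hTop (scaled (L ^ k) U₁)) z ν : R) - 1‖ ≤ X)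
    (x : Site d) (ν : Fin d) :
    ‖(pert U₀ (gaugeAct (multiComb (List.replicate k L) hTop U₀ U₁) U₁) x ν : R) - 1‖ ≤
      crossConst d L / ((L : ℝ) ^ 2 - 1) * (a₁ + a₀) + X :=
  multilevel_bound_regular k hU₀ hU₁ hh hL ha₁ ha₀ hX x ν

/-- Non-vacuity of `FineRegularOn`: the flat configuration satisfies it with `a = 0` at every bond. -/
example [NormOneClass R] (L k : ℕ) (x : Site d) (ν : Fin d) :
    FineRegularOn L k 0 (fun _ _ => (1 : Rˣ) : Cfg d R) x ν := by
  intro s ρ κ _ _ _ _ _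
  simp [plaq]

/-- Non-vacuity of the headline: for the flat pair with top gauge `1` every hypothesis holds with `a₁ = a₀ = 0`, the top
bond term vanishes, and the conclusion is the true statement `0 ≤ 0`. -/
example [NormOneClass R] {L : ℕ} (hL : 2 ≤ L) (k : ℕ) (x : Site d) (ν : Fin d) :
    ‖(pert (fun _ _ => (1 : Rˣ)) (gaugeAct (multiComb (List.replicate k L) (fun _ => 1) (fun _ _ => 1) (fun _ _ => 1))
      (fun _ _ => (1 : Rˣ))) x ν : R) - 1‖ ≤ crossConst d L / ((L : ℝ) ^ 2 - 1) * (0 + 0) := by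
  have h1 : ∀ (x : Site d) (ν : Fin d), UnitaryLike ((fun _ _ => (1 : Rˣ)) x ν) := fun _ _ => UnitaryLike.one
  have hflat : ∀ M : ℕ, scaled M (fun _ _ => (1 : Rˣ)) = (fun _ _ => (1 : Rˣ) : Cfg d R) := by
    intro M; funext y μ
    exact hol_line_eq_one M (fun _ _ => rfl)
  have hreg : ∀ (y : Site d) (μ : Fin d), FineRegularOn L k 0 (fun _ _ => (1 : Rˣ) : Cfg d R) y μ := by
    intro y μ s ρ κ _ _ _ _ _; simp [plaq]
  refine same_top_bond_bound k h1 h1 (fun _ => UnitaryLike.one) hL x ν (hreg x ν) (hreg x ν) (by norm_num) ?_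
  rw [hflat]; simp [gaugeAct]

/-- The hypothesis `0 ≤ a₁ + a₀` is NEEDED at `k = 0` (`d ≥ 2`): there the region `{x, x + e_ν}` has no plaquette, the
local regularity is vacuous for EVERY `a` — e.g. `a = −1` for the flat configuration. -/
example [NormOneClass R] (L : ℕ) (x : Site d) (ν : Fin d) :
    FineRegularOn L 0 (-1) (fun _ _ => (1 : Rˣ) : Cfg d R) x ν := by
  intro s ρ κ hρκ h1 _ _ h4
  exfalso
  rw [inPair_iff_box] at h1 h4
  obtain ⟨h1ρ, -⟩ := h1 ρ
  obtain ⟨-, h4ρ⟩ := h4 ρ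
  obtain ⟨h1κ, -⟩ := h1 κ
  obtain ⟨-, h4κ⟩ := h4 κ
  have hκρ : κ ≠ ρ := fun h => hρκ h.symm
  have eρρ : e ρ ρ = 1 := by simp [e]
  have eκκ : e κ κ = 1 := by simp [e]
  have eκρ : e κ ρ = 0 := by simp [e, hρκ]
  have eρκ : e ρ κ = 0 := by simp [e, hκρ]
  simp only [pow_zero, Nat.cast_one, one_mul, Pi.add_apply, eρρ, eκκ, eκρ, eρκ] at h1ρ h4ρ h1κ h4κ
  by_cases hρ : ρ = ν
  · have hκ : κ ≠ ν := fun h => hρκ (hρ.trans h.symm)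
    rw [if_neg hκ] at h4κ
    omega
  · rw [if_neg hρ] at h4ρ
    omega

/-- The pair region as a box, on numbers: in `d = 2` with `L = 3`, corner `0` and direction `0`, the site `(4, 2)` lies in
the pair (`0 ≤ 4 < 6`, `0 ≤ 2 < 3`) and `(4, 3)` does not. -/
example : InPair 3 (fun _ => 0 : Fin 2 → ℤ) 0 ![4, 2] ∧ ¬ InPair 3 (fun _ => 0 : Fin 2 → ℤ) 0 ![4, 3] := by
  rw [inPair_iff_box, inPair_iff_box]
  constructor
  · intro κ; fin_cases κ <;> simp
  · intro h; have := h 1; simp at this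

/-- Nested block indices on numbers: `⌊⌊−7/2⌋/3⌋ = ⌊−7/6⌋ = −2`. -/
example : blockIndex 3 (blockIndex 2 (fun _ => (-7 : ℤ) : Fin 1 → ℤ)) = fun _ => -2 := by
  rw [blockIndex_blockIndex]; funext i; simp [blockIndex_apply]


end Literature.MathematicalPhysics.QuantumFieldTheory.Balaban1983to89.T4MultilevelCombLocal
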